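import Literature.Computability.QuantumComplexity.OracleSeparationBQPPH
import Literature.Computability.Complexity.ACRealize
import Literature.Computability.Complexity.PolyTimeCountable
import Literature.Computability.Complexity.TM2Iterate
import Literature.Computability.QuantumComplexity.RazTalBoundedDepth
import HarnessLib

/-!
# Raz–Tal, Appendix A: discharges of the classical named facts

Sibling of `OracleSeparationBQPPH.lean` (the reduction of **quantum-advantage.S14**,
`exists_oracle_BQPRel_not_subset_PHRel`, to named facts). Here two of those facts are *proved*:

* `fSS84_phWindowCircuits_holds : FSS84_phWindowCircuits` — the `PH ↦ AC⁰` conversion for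
  window circuits (Furst–Saxe–Sipser 1984; in the precise form of Ko 1989, Lemma 2.1 — the
  innermost `P^A` computation at a fixed input is an OR over its accepting paths of ANDs of
  oracle literals — and Lemma 2.3 — each bounded quantifier becomes one unbounded fan-in gate over
  all witnesses), built with the depth-and-size toolkit `ACReal` of `Complexity/ACRealize.lean`;
* `countable_polyTimeOracleAlg_holds : countable_polyTimeOracleAlg` — from
  `countable_setOf_isPolyTime` of `Complexity/PolyTimeCountable.lean` (standard form of
  Mathlib's `Turing.FinTM2` machines);

and the reduction is restated with the two remaining hypotheses
(`exists_oracle_BQPRel_not_subset_PHRel_of_bqpMachine_of_thm74`): the uniform `BQP^O` machine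
running `Q₁` (`RazTal2022_bqpMachine`, a Turing-machine-to-uniform-circuit compiler statement in
the model `QCircuitFamily.IsUniform`) and Raz–Tal's Theorem 7.4 (`RazTal2022_thm74`), and — since
file `RazTalBoundedDepth` derives Theorem 7.4 from Tal's Fourier tail bound — with the hypotheses
`RazTal2022_bqpMachine` and `Tal2017_fourierL1_ac0`
(`exists_oracle_BQPRel_not_subset_PHRel_of_bqpMachine_of_tal`).

## The window circuits (Ko 1989, §2)

For an oracle algorithm `M`, an input `z` and a round budget `k`, `AccPath M z k ans bs` says that
the answer bits `bs` lead `M` (continuing the transcript `ans`) to the output `true` within `k`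
rounds, and `pathAtoms` lists the queries met on the way with the bits they must receive;
`runAux_eq_some_true_iff` is Ko's Lemma 2.1 (c). Against the oracle
`truncLang (patchLang A₀ e w) B` of a background `A₀` patched by the window `w` on the addresses
`e`, each condition "query `y` receives bit `b`" is a literal `wᵢ = b` (if `y = e i` is below the
cut-off `B`) or a constant (`toAtom`, `toAtom_eval`), so the base predicate is an OR over the
`< 2^{B+1}` answer sequences of ANDs of literals (`acReal_baseLang`: depth `2`, size
`≤ 2^{2B+2}`), and each quantifier `∃ y, |y| ≤ p(|x|) ∧ ⟨x,y⟩ ∉ …` is an OR over the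
`< 2^{p(|x|)+1}` witnesses of negated lower circuits (`acReal_levelLang`: depth `|ps| + 2`, size
`≤ 2^{sizeExp}` with `sizeExp (p :: ps) = p + sizeExp ps ∘ (2X + 2 + p) + 2`).

## References

* K.-I Ko, *Constructing oracles by lower bound techniques for circuits* (1989), Lemmas 2.1, 2.3.
* M. Furst, J. B. Saxe, M. Sipser, Math. Systems Theory 17 (1984).
* R. Raz, A. Tal, J. ACM 69 (2022), App. A.
* S. Arora, B. Barak (2009), §1.4.1.
-/

namespace Literature.Computability.QuantumComplexity

open _root_.Computability Complexity Finset

section PHCircuits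

/-! ### Oracle-free paths of an oracle algorithm (Ko 1989, Lemma 2.1: accepting paths) -/

variable (M : OracleAlg Bool) (z : List Bool)

/-- `AccPath M z k ans bs`: continuing from the answer transcript `ans` and receiving the answer
bits `bs` (in order) to its next queries, `M` on input `z` outputs `true` within `k` rounds,
exactly when the bits `bs` are used up (Ko 1989, proof of Lemma 2.1: "for each accepting path
`π` …"). [cite: Ko1989, Lemma 2.1] -/
def AccPath : ℕ → List (List Bool) → List Bool → Prop
  | 0, _, _ => False
  | k + 1, ans, bs =>
    match M.step z ans with
    | Sum.inr b => b = true ∧ bs = []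
    | Sum.inl _ =>
      match bs with
      | [] => False
      | b :: bs' => AccPath k (ans ++ [encodeBool b]) bs'

/-- The queries asked along the path with answer bits `bs`, each paired with the answer bit it
received (Ko 1989, proof of Lemma 2.1: the sets `Y_π`, `N_π` of queries answered yes/no on the
path `π`). [cite: Ko1989, Lemma 2.1] -/
def pathAtoms : ℕ → List (List Bool) → List Bool → List (List Bool × Bool)
  | 0, _, _ => []
  | k + 1, ans, bs =>
    match M.step z ans with
    | Sum.inr _ => []
    | Sum.inl y =>
      match bs with
      | [] => []
      | b :: bs' => (y, b) :: pathAtoms k (ans ++ [encodeBool b]) bs'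

/-- **Runs as accepting paths** (Ko 1989, Lemma 2.1 (c): "`M^A(x)` accepts iff there exists an
accepting path `π` such that `Y_π ⊆ A` and `N_π ⊆ Ā`"): against the oracle answering `y` by the
bit `bit y`, `M` outputs `true` within `k` rounds iff some answer sequence `bs` is an accepting
path all of whose queries are answered as recorded. [cite: Ko1989, Lemma 2.1] -/
theorem runAux_eq_some_true_iff (bit : List Bool → Bool) :
    ∀ (k : ℕ) (ans : List (List Bool)),
      M.runAux (fun y => encodeBool (bit y)) z k ans = some true ↔
        ∃ bs, AccPath M z k ans bs ∧ ∀ a ∈ pathAtoms M z k ans bs, bit a.1 = a.2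
  | 0, ans => by simp [OracleAlg.runAux, AccPath]
  | k + 1, ans => by
    unfold OracleAlg.runAux AccPath pathAtoms
    cases hs : M.step z ans with
    | inr b =>
      simp only [Option.some.injEq]
      constructor
      · intro hb; exact ⟨[], ⟨hb, rfl⟩, by simp⟩
      · rintro ⟨bs, ⟨hb, -⟩, -⟩; exact hb
    | inl y =>
      simp only
      rw [runAux_eq_some_true_iff bit k (ans ++ [encodeBool (bit y)])]
      constructor
      · rintro ⟨bs', hacc, hcons⟩
        exact ⟨bit y :: bs', hacc, fun a ha => by
          simp only [List.mem_cons] at ha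
          rcases ha with rfl | ha
          · rfl
          · exact hcons a ha⟩
      · rintro ⟨bs, hacc, hcons⟩
        cases bs with
        | nil => exact absurd hacc id
        | cons b bs' =>
          have hb : bit y = b := hcons (y, b) (by simp)
          subst hb
          exact ⟨bs', hacc, fun a ha => hcons a (by simp [ha])⟩

/-- An accepting path within `k` rounds has at most `k` answer bits. [cite: Ko1989, Lemma 2.1] -/
theorem length_le_of_accPath : ∀ (k : ℕ) (ans : List (List Bool)) (bs : List Bool),
    AccPath M z k ans bs → bs.length ≤ k
  | 0, _, _, h => absurd h id
  | k + 1, ans, bs, h => by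
    unfold AccPath at h
    cases hs : M.step z ans with
    | inr b => rw [hs] at h; simp [h.2]
    | inl y =>
      rw [hs] at h
      cases bs with
      | nil => exact absurd h id
      | cons b bs' =>
        simp only at h
        simpa using length_le_of_accPath k _ bs' h

/-- A path has at most as many queries as answer bits. [cite: Ko1989, Lemma 2.1] -/
theorem length_pathAtoms_le : ∀ (k : ℕ) (ans : List (List Bool)) (bs : List Bool),
    (pathAtoms M z k ans bs).length ≤ bs.length
  | 0, _, _ => by simp [pathAtoms]
  | k + 1, ans, bs => by
    unfold pathAtoms
    cases M.step z ans with
    | inr b => simp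
    | inl y =>
      cases bs with
      | nil => simp
      | cons b bs' => simpa using length_pathAtoms_le k _ bs'

/-! ### Atoms: the oracle bits of a patched window as literals or constants -/

variable {W : ℕ}

/-- An atom of a path condition, as a function of the window `w ∈ {0,1}^W`: a literal `wᵢ = b`,
or a constant truth value (queries off the window or beyond the cut-off). [cite: Ko1989, Lemma 2.1] -/
inductive Atom (W : ℕ)
  /-- the condition `w i = b` -/
  | lit (i : Fin W) (b : Bool)
  /-- a constant condition -/
  | const (c : Bool)

/-- Truth value of an atom on a window. [folklore] -/
def Atom.eval : Atom W → (Fin W → Bool) → Bool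
  | .lit i b, w => decide (w i = b)
  | .const c, _ => c

/-- A literal atom is realized at depth `0` with at most one (negation) gate. [cite: Vollmer1999, §1.2] -/
theorem acReal_atom_lit (i : Fin W) (b : Bool) : ACReal (Atom.lit i b).eval 0 1 := by
  cases b
  · exact (acReal_notInput i).congr fun w => by simp [Atom.eval]
  · exact ((acReal_input i).mono le_rfl (by norm_num)).congr fun w => by simp [Atom.eval]

/-- Whether an atom is a literal. [folklore] -/
def Atom.isLit : Atom W → Bool
  | .lit _ _ => true
  | .const _ => false

/-- **A conjunction of atoms is a depth-1 circuit** (an `∧` of literals, or a constant): if some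
constant atom is `false` the conjunction is the constant `false`; otherwise it is the `∧` of its
literal atoms. Size at most `|L| + 1`. [cite: Ko1989, Lemma 2.1] [cite: Vollmer1999, §1.2] -/
theorem acReal_allAtoms (L : List (Atom W)) :
    ACReal (fun w => decide (∀ a ∈ L, a.eval w = true)) 1 (L.length + 1) := by
  by_cases hF : Atom.const false ∈ L
  · refine ((acReal_const (ι := Fin W) false).mono le_rfl (by omega)).congr fun w => ?_
    symm
    rw [decide_eq_false_iff_not]
    intro h
    simpa [Atom.eval] using h _ hF
  · have key : ∀ w, (∀ a ∈ L, a.eval w = true) ↔ ∀ a ∈ L.filter Atom.isLit, a.eval w = true := by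
      intro w
      constructor
      · intro h a ha; exact h a (List.mem_of_mem_filter ha)
      · intro h a ha
        cases a with
        | lit i b => exact h _ (List.mem_filter.2 ⟨ha, rfl⟩)
        | const c =>
          cases c
          · exact absurd ha hF
          · rfl
    have hblk : ∀ j : Fin (L.filter Atom.isLit).length,
        ACReal ((L.filter Atom.isLit)[j.1]).eval 0 1 := by
      intro j
      have hm : (L.filter Atom.isLit)[j.1] ∈ L.filter Atom.isLit := List.getElem_mem _
      obtain ⟨-, hl⟩ := List.mem_filter.1 hm
      revert hl
      cases (L.filter Atom.isLit)[j.1] with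
      | lit i b => intro; exact acReal_atom_lit i b
      | const c => intro hl; exact absurd hl (by simp [Atom.isLit])
    have h := acReal_forall hblk
    refine (h.mono le_rfl ?_).congr fun w => ?_
    · simp only [Finset.sum_const, Finset.card_univ, Fintype.card_fin, smul_eq_mul, mul_one]
      have := List.length_filter_le Atom.isLit L
      omega
    · simp only [decide_eq_decide]
      rw [key]
      constructor
      · intro H a ha
        obtain ⟨j, hj, rfl⟩ := List.getElem_of_mem ha
        exact H ⟨j, hj⟩
      · intro H j; exact H _ (List.getElem_mem _)

variable (A₀ : Language Bool) (e : Fin W → List Bool) (B : ℕ)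

/-- The oracle bit of the query `y` against the patched, cut-off oracle, as a function of the
window. [cite: RazTalJACM2022, App. A] -/
noncomputable def bitFn (y : List Bool) (w : Fin W → Bool) : Bool :=
  (truncLang (patchLang A₀ e w) B).boolIndicator y

open scoped Classical in
/-- Classification of the condition "query `y` is answered `b`" as an atom: a literal if `y` is
the address of a window bit (below the cut-off), otherwise a constant. [cite: Ko1989, Lemma 2.3] -/
noncomputable def toAtom (a : List Bool × Bool) : Atom W :=
  if h : ∃ i, e i = a.1 then
    (if a.1.length ≤ B then Atom.lit (Classical.choose h) a.2 else Atom.const (decide (false = a.2)))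
  else Atom.const (decide (decide (a.1 ∈ A₀ ∧ a.1.length ≤ B) = a.2))

variable {A₀ e B}

/-- The atom of `(y, b)` evaluates to `[bit(y) = b]`. [cite: Ko1989, Lemma 2.3] -/
theorem toAtom_eval (hinj : Function.Injective e) (a : List Bool × Bool) (w : Fin W → Bool) :
    (toAtom A₀ e B a).eval w = decide (bitFn A₀ e B a.1 w = a.2) := by
  obtain ⟨y, b⟩ := a
  unfold toAtom bitFn
  simp only
  by_cases h : ∃ i, e i = y
  · rw [dif_pos h]
    have hi : e (Classical.choose h) = y := Classical.choose_spec h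
    have hmem : e (Classical.choose h) ∈ patchLang A₀ e w ↔ w (Classical.choose h) = true :=
      mem_patchLang_of_eq hinj w _
    rw [hi] at hmem
    by_cases hl : y.length ≤ B
    · rw [if_pos hl]
      simp only [Atom.eval]
      have : (truncLang (patchLang A₀ e w) B).boolIndicator y = w (Classical.choose h) := by
        cases hw : w (Classical.choose h)
        · exact (Set.notMem_iff_boolIndicator _ _).1 fun hm => by
            have := hmem.1 hm.1; rw [hw] at this; exact Bool.noConfusion this
        · exact (Set.mem_iff_boolIndicator _ _).1 ⟨hmem.2 hw, hl⟩
      rw [this]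
    · rw [if_neg hl]
      simp only [Atom.eval]
      have : (truncLang (patchLang A₀ e w) B).boolIndicator y = false :=
        (Set.notMem_iff_boolIndicator _ _).1 fun hm => hl hm.2
      rw [this]
  · rw [dif_neg h]
    simp only [Atom.eval]
    push Not at h
    have hmem : y ∈ patchLang A₀ e w ↔ y ∈ A₀ := mem_patchLang_of_not_mem_range w h
    have key : ∀ (d : Decidable (y ∈ A₀ ∧ y.length ≤ B)),
        @decide (y ∈ A₀ ∧ y.length ≤ B) d = (truncLang (patchLang A₀ e w) B).boolIndicator y := by
      intro d
      cases d with
      | isTrue hm =>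
        exact ((Set.mem_iff_boolIndicator (truncLang (patchLang A₀ e w) B) y).1
          (show y ∈ truncLang (patchLang A₀ e w) B from ⟨hmem.2 hm.1, hm.2⟩)).symm
      | isFalse hm =>
        exact ((Set.notMem_iff_boolIndicator (truncLang (patchLang A₀ e w) B) y).1
          fun h' => hm ⟨hmem.1 h'.1, h'.2⟩).symm
    rw [key]

/-! ### The base predicate is a DNF (Ko 1989, Lemma 2.1) -/

/-- Answer sequences of length at most `B`, as a finite type. [folklore] -/
abbrev Paths (B : ℕ) : Type := Σ n : Fin (B + 1), (Fin n → Bool)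

/-- There are `2^{B+1} − 1 ≤ 2^{B+1}` answer sequences of length at most `B`. [folklore] -/
theorem card_paths_le (B : ℕ) : Fintype.card (Paths B) ≤ 2 ^ (B + 1) := by
  rw [Fintype.card_sigma]
  simp only [Fintype.card_fun, Fintype.card_bool, Fintype.card_fin]
  rw [Fin.sum_univ_eq_sum_range (fun n => 2 ^ n) (B + 1)]
  have := Nat.geomSum_eq (le_refl 2) (B + 1)
  rw [this]
  exact Nat.div_le_self _ _ |>.trans (Nat.sub_le _ _)

/-- **Ko 1989, Lemma 2.1, for windows**: the base predicate `[z ∈ baseLang M q (A₀ patched by w)]`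
is computed by a depth-2 circuit (an OR over accepting paths of ANDs of literals) of size at most
`2^{2 q(|z|) + 2}`. [cite: Ko1989, Lemma 2.1] -/
theorem acReal_baseLang (hinj : Function.Injective e) (M : OracleAlg Bool) (q : Polynomial ℕ)
    (A₀ : Language Bool) (z : List Bool) :
    ACReal (fun w => (baseLang M q (patchLang A₀ e w)).boolIndicator z) 2
      (2 ^ (2 * q.eval z.length + 2)) := by
  classical
  set B := q.eval z.length with hB
  -- block of a path
  let blk : Paths B → (Fin W → Bool) → Bool := fun t w =>
    decide (AccPath M z B [] (List.ofFn t.2)) &&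
      decide (∀ a ∈ (pathAtoms M z B [] (List.ofFn t.2)).map (toAtom A₀ e B), a.eval w = true)
  have hblk : ∀ t, ACReal (blk t) 1 (B + 1) := by
    intro t
    by_cases hacc : AccPath M z B [] (List.ofFn t.2)
    · have h := acReal_allAtoms ((pathAtoms M z B [] (List.ofFn t.2)).map (toAtom A₀ e B))
      refine (h.mono le_rfl ?_).congr fun w => by simp [blk, hacc]
      rw [List.length_map]
      have h1 := length_pathAtoms_le M z B [] (List.ofFn t.2)
      have h2 := length_le_of_accPath M z B [] _ hacc
      omega
    · exact ((acReal_const false).mono le_rfl (by omega)).congr fun w => by simp [blk, hacc]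
  have h := acReal_exists_fintype hblk
  refine (h.mono le_rfl ?_).congr fun w => ?_
  · -- size
    have hc := card_paths_le B
    calc Fintype.card (Paths B) * (B + 1) + 1 ≤ 2 ^ (B + 1) * (B + 1) + 1 := by
          exact Nat.add_le_add_right (Nat.mul_le_mul_right _ hc) 1
      _ ≤ 2 ^ (B + 1) * (B + 1) + 2 ^ (B + 1) := by
          exact Nat.add_le_add_left Nat.one_le_two_pow _
      _ = 2 ^ (B + 1) * (B + 2) := by ring
      _ ≤ 2 ^ (B + 1) * 2 ^ (B + 1) := by
          refine Nat.mul_le_mul_left _ ?_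
          clear hc h hblk blk hB
          induction B with
          | zero => norm_num
          | succ n ih => rw [pow_succ]; omega
      _ = 2 ^ (2 * B + 2) := by rw [← pow_add]; ring_nf
  · -- semantics
    have hsem : z ∈ baseLang M q (patchLang A₀ e w) ↔ ∃ t : Paths B, blk t w = true := by
      change M.run (Oracle.ofLanguage (truncLang (patchLang A₀ e w) (q.eval z.length)))
        (q.eval z.length) z = some true ↔ _
      rw [← hB]
      have hO : Oracle.ofLanguage (truncLang (patchLang A₀ e w) B) =
          fun y => encodeBool (bitFn A₀ e B y w) := rfl
      rw [OracleAlg.run, hO, runAux_eq_some_true_iff]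
      constructor
      · rintro ⟨bs, hacc, hcons⟩
        have hlen : bs.length < B + 1 := Nat.lt_succ_of_le (length_le_of_accPath M z B [] bs hacc)
        refine ⟨⟨⟨bs.length, hlen⟩, fun j => bs[j]⟩, ?_⟩
        have hofFn : List.ofFn (fun j : Fin bs.length => bs[j]) = bs := List.ofFn_getElem (xs := bs)
        simp only [blk, hofFn, hacc, decide_true, Bool.true_and, decide_eq_true_eq]
        intro a ha
        rw [List.mem_map] at ha
        obtain ⟨a', ha', rfl⟩ := ha
        rw [toAtom_eval hinj]
        exact decide_eq_true (hcons a' ha')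
      · rintro ⟨t, ht⟩
        simp only [blk, Bool.and_eq_true, decide_eq_true_eq] at ht
        obtain ⟨hacc, hall⟩ := ht
        refine ⟨List.ofFn t.2, hacc, fun a ha => ?_⟩
        have := hall (toAtom A₀ e B a) (List.mem_map.2 ⟨a, ha, rfl⟩)
        rw [toAtom_eval hinj] at this
        exact of_decide_eq_true this
    by_cases hz : z ∈ baseLang M q (patchLang A₀ e w)
    · rw [(Set.mem_iff_boolIndicator _ _).1 hz]
      exact decide_eq_true (hsem.1 hz)
    · rw [(Set.notMem_iff_boolIndicator _ _).1 hz]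
      exact decide_eq_false fun h => hz (hsem.2 h)

/-! ### The quantifier levels (Ko 1989, Lemma 2.3) -/

/-- The exponent of the size bound, by recursion on the quantifier prefix: `2q + 2` for the base,
and `p + S(2X + 2 + p) + 2` for one more quantifier with length bound `p` (the paired input
`⟨x, y⟩` has length `2|x| + 2 + |y|`). [cite: Ko1989, Lemma 2.3] -/
noncomputable def sizeExp (q : Polynomial ℕ) : List (Polynomial ℕ) → Polynomial ℕ
  | [] => 2 * q + 2
  | p :: ps => p + (sizeExp q ps).comp (2 * Polynomial.X + 2 + p) + 2

/-- Unfolding the size exponent at a quantifier. [folklore] -/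
theorem sizeExp_cons_eval (q p : Polynomial ℕ) (ps : List (Polynomial ℕ)) (n : ℕ) :
    (sizeExp q (p :: ps)).eval n = p.eval n + (sizeExp q ps).eval (2 * n + 2 + p.eval n) + 2 := by
  simp [sizeExp, Polynomial.eval_comp]

/-- The size exponent is at least `2`. [folklore] -/
theorem two_le_sizeExp_eval (q : Polynomial ℕ) (ps : List (Polynomial ℕ)) (n : ℕ) :
    2 ≤ (sizeExp q ps).eval n := by
  cases ps with
  | nil => simp [sizeExp]
  | cons p ps => rw [sizeExp_cons_eval]; omega

/-- **Ko 1989, Lemma 2.3, for windows**: the predicate with quantifier prefix `ps` at input `x`,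
as a function of the window, is computed by a circuit of depth `|ps| + 2` and size at most
`2^{sizeExp(|x|)}` (each `∃ᵖ` becomes an OR over the `< 2^{p(|x|)+1}` witnesses of the negated
circuits of the lower level). [cite: Ko1989, Lemma 2.3] -/
theorem acReal_levelLang (hinj : Function.Injective e) (M : OracleAlg Bool) (q : Polynomial ℕ)
    (A₀ : Language Bool) : ∀ (ps : List (Polynomial ℕ)) (x : List Bool),
    ACReal (fun w => (levelLang M q (patchLang A₀ e w) ps).boolIndicator x) (ps.length + 2)
      (2 ^ (sizeExp q ps).eval x.length)
  | [], x => by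
    have h := acReal_baseLang hinj M q A₀ x
    refine h.mono le_rfl (Nat.pow_le_pow_right (by norm_num) ?_)
    simp [sizeExp]
  | p :: ps, x => by
    classical
    set P := p.eval x.length with hP
    set s := (sizeExp q ps).eval (2 * x.length + 2 + P) with hs
    -- the blocks: negated lower-level circuits at the paired inputs
    let blk : Paths P → (Fin W → Bool) → Bool := fun t w =>
      !(levelLang M q (patchLang A₀ e w) ps).boolIndicator (boolPair x (List.ofFn t.2))
    have hblk : ∀ t, ACReal (blk t) (ps.length + 2) (2 ^ s + 1) := by
      intro t
      have h := (acReal_levelLang hinj M q A₀ ps (boolPair x (List.ofFn t.2))).neg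
      refine h.mono le_rfl (Nat.add_le_add_right (Nat.pow_le_pow_right (by norm_num) ?_) 1)
      refine TM2Iter.eval_mono _ ?_
      rw [length_boolPair, List.length_ofFn]
      have := t.1.isLt
      omega
    have h := acReal_exists_fintype hblk
    have hs2 : 2 ≤ 2 ^ s := by
      have := two_le_sizeExp_eval q ps (2 * x.length + 2 + P)
      calc 2 = 2 ^ 1 := rfl
        _ ≤ 2 ^ s := Nat.pow_le_pow_right (by norm_num) (by omega)
    refine (h.mono (by simp only [List.length_cons]; omega) ?_).congr fun w => ?_
    · -- size: `card · (2^s + 1) + 1 ≤ 2^(P + s + 2)`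
      rw [sizeExp_cons_eval, ← hP, ← hs]
      have hc := card_paths_le P
      calc Fintype.card (Paths P) * (2 ^ s + 1) + 1
          ≤ 2 ^ (P + 1) * (2 ^ s + 1) + 1 := Nat.add_le_add_right (Nat.mul_le_mul_right _ hc) 1
        _ ≤ 2 ^ (P + 1) * (2 ^ s + 1) + 2 ^ (P + 1) * 1 :=
            Nat.add_le_add_left (by rw [mul_one]; exact Nat.one_le_two_pow) _
        _ = 2 ^ (P + 1) * (2 ^ s + 2) := by ring
        _ ≤ 2 ^ (P + 1) * 2 ^ (s + 1) := by
            refine Nat.mul_le_mul_left _ ?_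
            rw [pow_succ]; omega
        _ = 2 ^ (P + s + 2) := by rw [← pow_add]; ring_nf
    · -- semantics
      by_cases hx : x ∈ levelLang M q (patchLang A₀ e w) (p :: ps)
      · rw [(Set.mem_iff_boolIndicator _ _).1 hx]
        refine decide_eq_true ?_
        obtain ⟨y, hy, hny⟩ := (mem_levelLang_cons M q _ p ps x).1 hx
        have hlen : y.length < P + 1 := Nat.lt_succ_of_le hy
        refine ⟨⟨⟨y.length, hlen⟩, fun j => y[j]⟩, ?_⟩
        have hofFn : List.ofFn (fun j : Fin y.length => y[j]) = y := List.ofFn_getElem (xs := y)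
        simp only [blk, hofFn, Bool.not_eq_true']
        exact (Set.notMem_iff_boolIndicator _ _).1 hny
      · rw [(Set.notMem_iff_boolIndicator _ _).1 hx]
        refine decide_eq_false ?_
        rintro ⟨t, ht⟩
        simp only [blk, Bool.not_eq_true'] at ht
        refine hx ((mem_levelLang_cons M q _ p ps x).2 ⟨List.ofFn t.2, ?_, ?_⟩)
        · rw [List.length_ofFn]; have := t.1.isLt; omega
        · exact (Set.notMem_iff_boolIndicator _ _).2 ht

/-- **`FSS84_phWindowCircuits` holds** (Furst–Saxe–Sipser 1984; Ko 1989, Lemmas 2.1 and 2.3):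
every `PH^A` description, at every input, is an `AC⁰` function of depth `|bounds| + 2` and size
`2^{poly}` of any injectively addressed finite window of the oracle. [cite: Ko1989, Lemma 2.1 and Lemma 2.3] [cite: FurstSaxeSipser1984] -/
theorem fSS84_phWindowCircuits_holds : FSS84_phWindowCircuits := by
  intro D
  refine ⟨sizeExp D.q D.bounds, fun x W e hinj A₀ => ?_⟩
  obtain ⟨C, hC, hd, hs, hev⟩ := (acReal_levelLang hinj D.M D.q A₀ D.bounds x).toCircuit
  exact ⟨C, hC, hd, hs, hev⟩

end PHCircuits


/-! ### Countability of polynomial-time oracle machines, and the reduced assembly -/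

/-- **`countable_polyTimeOracleAlg` holds**: there are countably many polynomial-time oracle
algorithms (`countable_setOf_isPolyTime`: every `TM2` machine is simulated by a standard machine,
an element of a countable type, which determines the computed step function). [cite: AroraBarak2009, §1.4.1] -/
theorem countable_polyTimeOracleAlg_holds : countable_polyTimeOracleAlg :=
  countable_setOf_isPolyTime encodingBoolBool

/-- **Raz–Tal, Corollary 1.5, from the two remaining named facts**: the uniform `BQP^O` machine
running `Q₁` on the level-`n` window (`RazTal2022_bqpMachine`, App. A with Claim 8.1) and
Theorem 7.4 (`RazTal2022_thm74`) imply that there is an oracle `A` with `BQP^A ⊄ PH^A`; Claim 8.1,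
the `PH ↦ AC⁰` conversion and the enumeration of `PH` machines are proved
(`razTal2022_claim81_holds`, `fSS84_phWindowCircuits_holds`, `countable_polyTimeOracleAlg_holds`).
[cite: RazTalJACM2022, Cor. 1.5 (App. A)] -/
theorem exists_oracle_BQPRel_not_subset_PHRel_of_bqpMachine_of_thm74 (h1 : RazTal2022_bqpMachine)
    (h74 : RazTal2022_thm74) : exists_oracle_BQPRel_not_subset_PHRel :=
  exists_oracle_BQPRel_not_subset_PHRel_of h1 razTal2022_claim81_holds fSS84_phWindowCircuits_holds
    countable_polyTimeOracleAlg_holds h74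

/-- **Raz–Tal, Corollary 1.5, from the `BQP^O` machine and Tal's tail bound**: with Theorem 7.4
derived from Tal's Fourier tail bound for `AC⁰` (`razTal2022_thm74_of_tal`, file
`RazTalBoundedDepth`), the oracle separation `∃ A, BQP^A ⊄ PH^A` rests on the uniform `BQP^O`
machine running `Q₁` (`RazTal2022_bqpMachine`, App. A) and on `Tal2017_fourierL1_ac0`
(Raz–Tal's Lemma 7.1) alone. [cite: RazTalJACM2022, Cor. 1.5 (App. A)] -/
theorem exists_oracle_BQPRel_not_subset_PHRel_of_bqpMachine_of_tal (h1 : RazTal2022_bqpMachine)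
    (hT : Tal2017_fourierL1_ac0) : exists_oracle_BQPRel_not_subset_PHRel :=
  exists_oracle_BQPRel_not_subset_PHRel_of_bqpMachine_of_thm74 h1 (razTal2022_thm74_of_tal hT)

end Literature.Computability.QuantumComplexity
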